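import Mathlib
import HarnessLib
import Summits.NavierStokesRegularity.NavierStokesRegularity.Theorems.PoloidalWindowDoorLrcModEntireLeafwiseVertical

/-!
# Route `PoloidalWindowDoor`, crux `PoloidalWindowRigidity` (K2, stmt-NavierStokesRegularity-19708), skeleton `lrc-jet` v5,
# stub `stub_untwisted` — brick F3a: THE VERTICAL-LINE CALCULUS OF AN UNTWISTED FOLIATION AND BRANCH 1 OF THE SEPARATION
# (where the height-Wronskian `D₁` of the divergence identity is non-zero, `|∇ₕw|²` and `Δₕw` are LEAFWISE)

Cell ns-regularity-ideate, K2 lead ns-poloidal-K2-p1 (gen 6; `--supports stmt-NavierStokesRegularity-19708`, helper toward the registered stub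
`stub_untwisted` of `Cruxes/PoloidalWindowRigidity/Lines/lrc_jet.lean` v5; paper proof = `Cruxes/PoloidalWindowRigidity/UNTWISTED-NOTE.md` §3,
CAS kit j283576).  Pure multivariable calculus on `ℝ³` (indices `0,1` horizontal, `2` the height), no Navier–Stokes object appears.

Setting.  `w : ℝ³ → ℝ` (the vertical velocity of a poloidal profile on one slice) is UNTWISTED on an open set `U`: its vertical derivative
is LEAFWISE, `∂₂w(y) = P(w(y), y₂)` for a structure function `P : ℝ × ℝ → ℝ` (nsreg-p7's «Case II»; for the twist bracket
`{∂₂w, w}ₕ ≡ 0` of the skeleton this `P` is produced by `Literature.Analysis.Calculus.exists_comp_slice`).  Write `E = (∂₀w)² + (∂₁w)²`,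
`M = ∂₀∂₀w + ∂₁∂₁w`, and for a function `g` of `p = (w(y), y₂)`: `g_w = Dg(p)(1,0)`, `ġ = Dg(p)(P(p),1)` (the derivative ALONG THE VERTICAL LINE).

* `fderiv_vert_hpartial` — `∂₂(∂_b w) = P_w ∂_b w` (`b = 0,1`);  `fderiv_vert_gradSq` — **`∂₂E = 2P_w E`**;
  `fderiv_vert_hpartial2` — `∂₂(∂_b∂_b w) = P_ww (∂_b w)² + P_w ∂_b∂_b w`;  `fderiv_vert_lap` — **`∂₂M = P_w M + P_ww E`**:
  along every vertical line `(E, M)` solve a LINEAR system of ODEs whose coefficients are functions of `(w, y₂)`.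
* `vert_deriv_divIdentity` — differentiating the leafwise DIVERGENCE IDENTITY `Λ(w,y₂)·M + Λ_w(w,y₂)·E + c(w,y₂) = 0` (for a poloidal germ:
  `Δₕ F(w,y₂) + ∂₂²w = 0`, `Λ = F_w` the shear slope, K2-p3's `exists_T0`) along `e₂` gives the second linear relation
  `(Λ̇ + ΛP_w)·M + (ΛP_ww + Λ̇_w + 2Λ_wP_w)·E + ċ = 0`.
* `leafwise_of_wronskian_ne_zero` — **BRANCH 1 (Cramer):** where the height-Wronskian
  `D₁ := Λ(ΛP_ww + Λ̇_w + 2Λ_wP_w) − Λ_w(Λ̇ + ΛP_w)` is non-zero, `E = a(w, y₂)` and `M = b(w, y₂)` for two explicit functions `a, b` of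
  `(w, y₂)` — on every horizontal plane `w` is ISOPARAMETRIC there (the input of `Literature/Analysis/Calculus/PlaneIsoparametric*`).

WHAT THIS IS NOT: not a claim about Navier–Stokes regularity and not the stub — calculus bookkeeping for its Branch 1 (bears_on LADDER-NS N0 via
crux K2 = stmt-19708).  Branch 2 (`D₁ ≡ 0`) and the endgame are the sequels.
-/

noncomputable section

-- the summit and its single sub-problem share the name (CONVENTIONS §1), as in every Theorems file
set_option linter.dupNamespace false

namespace Summit.NavierStokesRegularity.NavierStokesRegularity.Theorems.PoloidalWindowDoorPoloidalWindowRigidityUntwistedSeparation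

open Set Function Filter Topology
open Summit.NavierStokesRegularity.NavierStokesRegularity.Theorems.PoloidalWindowDoorPoloidalWindowRigidityConstantShearMeans
open Summit.NavierStokesRegularity.NavierStokesRegularity.Theorems.PoloidalWindowDoorLrcModEntireLeafwiseVertical

/-! ### Differentiability bookkeeping -/

/-- A first partial `y ↦ ∂ₐw(y)` of a `C²` function is differentiable. [folklore] -/
theorem differentiableAt_partial {w : EuclideanSpace ℝ (Fin 3) → ℝ} (hw : ContDiff ℝ 2 w) (a x : EuclideanSpace ℝ (Fin 3)) :
    DifferentiableAt ℝ (fun y => fderiv ℝ w y a) x :=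
  (((hw.fderiv_right (m := 1) (by norm_num)).clm_apply contDiff_const).differentiable one_ne_zero) x

/-- A first partial `y ↦ ∂ₐw(y)` of a `C³` function is `C²`. [folklore] -/
theorem contDiff_two_partial {w : EuclideanSpace ℝ (Fin 3) → ℝ} (hw : ContDiff ℝ 3 w) (a : EuclideanSpace ℝ (Fin 3)) :
    ContDiff ℝ 2 (fun y => fderiv ℝ w y a) :=
  (hw.fderiv_right (m := 2) (by norm_num)).clm_apply contDiff_const

/-- A second partial `y ↦ ∂_b∂ₐw(y)` of a `C³` function is differentiable. [folklore] -/
theorem differentiableAt_partial2 {w : EuclideanSpace ℝ (Fin 3) → ℝ} (hw : ContDiff ℝ 3 w) (a b x : EuclideanSpace ℝ (Fin 3)) :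
    DifferentiableAt ℝ (fun y => fderiv ℝ (fun y' => fderiv ℝ w y' a) y b) x :=
  differentiableAt_partial (contDiff_two_partial hw a) b x

/-- The `w`-partial `p ↦ Dg(p)(1,0)` of a function `g : ℝ × ℝ → ℝ` that is `C²` at `p` is differentiable at `p`. [folklore] -/
theorem differentiableAt_wPartial {g : ℝ × ℝ → ℝ} {p : ℝ × ℝ} (hg : ContDiffAt ℝ 2 g p) :
    DifferentiableAt ℝ (fun q => fderiv ℝ g q ((1 : ℝ), (0 : ℝ))) p := by
  have h1 : ContDiffAt ℝ 1 (fderiv ℝ g) p := hg.fderiv_right (m := 1) (by norm_num)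
  have h2 : ContDiffAt ℝ 1 (fun q => fderiv ℝ g q ((1 : ℝ), (0 : ℝ))) p := h1.clm_apply contDiffAt_const
  exact h2.differentiableAt one_ne_zero

/-! ### The vertical-line calculus of an untwisted function -/

section VerticalLine

variable {w : EuclideanSpace ℝ (Fin 3) → ℝ} {P : ℝ × ℝ → ℝ} {U : Set (EuclideanSpace ℝ (Fin 3))}

/-- **`∂₂(∂_b w) = P_w · ∂_b w`** for a horizontal index `b`, when `∂₂w = P(w, y₂)` on the open set `U`
(symmetry of second derivatives + the leaf chain rule). [folklore] -/
theorem fderiv_vert_hpartial (hU : IsOpen U) (hw : ContDiff ℝ 2 w)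
    (hPd : ∀ y ∈ U, DifferentiableAt ℝ P (w y, y 2))
    (hP : ∀ y ∈ U, fderiv ℝ w y (EuclideanSpace.single 2 (1 : ℝ)) = P (w y, y 2)) {y : EuclideanSpace ℝ (Fin 3)} (hy : y ∈ U) {b : Fin 3} (hb : b ≠ 2) :
    fderiv ℝ (fun y' => fderiv ℝ w y' (EuclideanSpace.single b (1 : ℝ))) y (EuclideanSpace.single 2 (1 : ℝ)) = fderiv ℝ P (w y, y 2) (1, 0) * fderiv ℝ w y (EuclideanSpace.single b (1 : ℝ)) := by
  have hwd : Differentiable ℝ w := hw.differentiable (by norm_num)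
  have hS : (fun y' => fderiv ℝ w y' (EuclideanSpace.single 2 (1 : ℝ))) =ᶠ[𝓝 y] fun y' => P (w y', y' 2) := by
    filter_upwards [hU.mem_nhds hy] with y' hy' using hP y' hy'
  rw [fderiv_fderiv_symm hw y (EuclideanSpace.single b (1 : ℝ)) (EuclideanSpace.single 2 (1 : ℝ)), hS.fderiv_eq, fderiv_leaf_comp_horizontal (hPd y hy) (hwd y) hb]
  ring

/-- **`∂₂E = 2P_w E`** for `E = (∂₀w)² + (∂₁w)²`. [folklore] -/
theorem fderiv_vert_gradSq (hU : IsOpen U) (hw : ContDiff ℝ 2 w)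
    (hPd : ∀ y ∈ U, DifferentiableAt ℝ P (w y, y 2))
    (hP : ∀ y ∈ U, fderiv ℝ w y (EuclideanSpace.single 2 (1 : ℝ)) = P (w y, y 2)) {y : EuclideanSpace ℝ (Fin 3)} (hy : y ∈ U) :
    fderiv ℝ (fun y' => fderiv ℝ w y' (EuclideanSpace.single 0 (1 : ℝ)) ^ 2 + fderiv ℝ w y' (EuclideanSpace.single 1 (1 : ℝ)) ^ 2) y (EuclideanSpace.single 2 (1 : ℝ)) =
      2 * fderiv ℝ P (w y, y 2) (1, 0) * (fderiv ℝ w y (EuclideanSpace.single 0 (1 : ℝ)) ^ 2 + fderiv ℝ w y (EuclideanSpace.single 1 (1 : ℝ)) ^ 2) := by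
  have hd := differentiableAt_partial hw
  have h0 : DifferentiableAt ℝ (fun y' : EuclideanSpace ℝ (Fin 3) => fderiv ℝ w y' (EuclideanSpace.single 0 (1 : ℝ)) ^ 2) y := (hd (EuclideanSpace.single 0 (1 : ℝ)) y).pow 2
  have h1 : DifferentiableAt ℝ (fun y' : EuclideanSpace ℝ (Fin 3) => fderiv ℝ w y' (EuclideanSpace.single 1 (1 : ℝ)) ^ 2) y := (hd (EuclideanSpace.single 1 (1 : ℝ)) y).pow 2
  rw [fderiv_fun_add h0 h1]
  simp only [_root_.add_apply]
  rw [fderiv_sq_apply (hd (EuclideanSpace.single 0 (1 : ℝ)) y), fderiv_sq_apply (hd (EuclideanSpace.single 1 (1 : ℝ)) y),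
    fderiv_vert_hpartial hU hw hPd hP hy (show (0 : Fin 3) ≠ 2 by decide),
    fderiv_vert_hpartial hU hw hPd hP hy (show (1 : Fin 3) ≠ 2 by decide)]
  ring

/-- **`∂₂(∂_b∂_b w) = P_ww (∂_b w)² + P_w ∂_b∂_b w`** for a horizontal index `b` (`w ∈ C³`, `P ∈ C²` at the leaf points of `U`). [folklore] -/
theorem fderiv_vert_hpartial2 (hU : IsOpen U) (hw : ContDiff ℝ 3 w)
    (hPd : ∀ y ∈ U, ContDiffAt ℝ 2 P (w y, y 2))
    (hP : ∀ y ∈ U, fderiv ℝ w y (EuclideanSpace.single 2 (1 : ℝ)) = P (w y, y 2)) {y : EuclideanSpace ℝ (Fin 3)} (hy : y ∈ U) {b : Fin 3} (hb : b ≠ 2) :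
    fderiv ℝ (fun y' => fderiv ℝ (fun y'' => fderiv ℝ w y'' (EuclideanSpace.single b (1 : ℝ))) y' (EuclideanSpace.single b (1 : ℝ))) y (EuclideanSpace.single 2 (1 : ℝ)) =
      fderiv ℝ (fun q => fderiv ℝ P q ((1 : ℝ), (0 : ℝ))) (w y, y 2) (1, 0) * fderiv ℝ w y (EuclideanSpace.single b (1 : ℝ)) ^ 2 +
        fderiv ℝ P (w y, y 2) (1, 0) * fderiv ℝ (fun y' => fderiv ℝ w y' (EuclideanSpace.single b (1 : ℝ))) y (EuclideanSpace.single b (1 : ℝ)) := by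
  have hw2 : ContDiff ℝ 2 w := hw.of_le (by norm_num)
  have hwd : Differentiable ℝ w := hw.differentiable (by norm_num)
  have hPd1 : ∀ y ∈ U, DifferentiableAt ℝ P (w y, y 2) := fun y hy => (hPd y hy).differentiableAt (by norm_num)
  -- the `C²` function `h = ∂_b w`
  have hh : ContDiff ℝ 2 (fun y'' => fderiv ℝ w y'' (EuclideanSpace.single b (1 : ℝ))) := contDiff_two_partial hw (EuclideanSpace.single b (1 : ℝ))
  rw [fderiv_fderiv_symm hh y (EuclideanSpace.single b (1 : ℝ)) (EuclideanSpace.single 2 (1 : ℝ))]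
  -- near `y`, `∂₂ h = P_w(w, y₂) · ∂_b w`
  have hS : (fun y' => fderiv ℝ (fun y'' => fderiv ℝ w y'' (EuclideanSpace.single b (1 : ℝ))) y' (EuclideanSpace.single 2 (1 : ℝ))) =ᶠ[𝓝 y]
      fun y' => fderiv ℝ P (w y', y' 2) (1, 0) * fderiv ℝ w y' (EuclideanSpace.single b (1 : ℝ)) := by
    filter_upwards [hU.mem_nhds hy] with y' hy' using fderiv_vert_hpartial hU hw2 hPd1 hP hy' hb
  rw [hS.fderiv_eq]
  have hPw : DifferentiableAt ℝ (fun y' : EuclideanSpace ℝ (Fin 3) => fderiv ℝ P (w y', y' 2) ((1 : ℝ), (0 : ℝ))) y :=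
    differentiableAt_leaf_comp (differentiableAt_wPartial (hPd y hy)) (hwd y)
  rw [fderiv_mul_apply hPw (differentiableAt_partial hw2 (EuclideanSpace.single b (1 : ℝ)) y),
    fderiv_leaf_comp_horizontal (differentiableAt_wPartial (hPd y hy)) (hwd y) hb]
  ring

/-- **`∂₂M = P_w M + P_ww E`** for `M = ∂₀∂₀w + ∂₁∂₁w`, `E = (∂₀w)² + (∂₁w)²`. [folklore] -/
theorem fderiv_vert_lap (hU : IsOpen U) (hw : ContDiff ℝ 3 w)
    (hPd : ∀ y ∈ U, ContDiffAt ℝ 2 P (w y, y 2))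
    (hP : ∀ y ∈ U, fderiv ℝ w y (EuclideanSpace.single 2 (1 : ℝ)) = P (w y, y 2)) {y : EuclideanSpace ℝ (Fin 3)} (hy : y ∈ U) :
    fderiv ℝ (fun y' => fderiv ℝ (fun y'' => fderiv ℝ w y'' (EuclideanSpace.single 0 (1 : ℝ))) y' (EuclideanSpace.single 0 (1 : ℝ)) +
        fderiv ℝ (fun y'' => fderiv ℝ w y'' (EuclideanSpace.single 1 (1 : ℝ))) y' (EuclideanSpace.single 1 (1 : ℝ))) y (EuclideanSpace.single 2 (1 : ℝ)) =
      fderiv ℝ P (w y, y 2) (1, 0) *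
          (fderiv ℝ (fun y' => fderiv ℝ w y' (EuclideanSpace.single 0 (1 : ℝ))) y (EuclideanSpace.single 0 (1 : ℝ)) + fderiv ℝ (fun y' => fderiv ℝ w y' (EuclideanSpace.single 1 (1 : ℝ))) y (EuclideanSpace.single 1 (1 : ℝ))) +
        fderiv ℝ (fun q => fderiv ℝ P q ((1 : ℝ), (0 : ℝ))) (w y, y 2) (1, 0) *
          (fderiv ℝ w y (EuclideanSpace.single 0 (1 : ℝ)) ^ 2 + fderiv ℝ w y (EuclideanSpace.single 1 (1 : ℝ)) ^ 2) := by
  rw [fderiv_fun_add (differentiableAt_partial2 hw (EuclideanSpace.single 0 (1 : ℝ)) (EuclideanSpace.single 0 (1 : ℝ)) y) (differentiableAt_partial2 hw (EuclideanSpace.single 1 (1 : ℝ)) (EuclideanSpace.single 1 (1 : ℝ)) y)]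
  simp only [_root_.add_apply]
  rw [fderiv_vert_hpartial2 hU hw hPd hP hy (show (0 : Fin 3) ≠ 2 by decide),
    fderiv_vert_hpartial2 hU hw hPd hP hy (show (1 : Fin 3) ≠ 2 by decide)]
  ring

end VerticalLine

/-! ### The divergence identity differentiated along the height -/

section DivIdentity

variable {w : EuclideanSpace ℝ (Fin 3) → ℝ} {P Λ c : ℝ × ℝ → ℝ} {U : Set (EuclideanSpace ℝ (Fin 3))}

/-- **The height-derivative of the leafwise divergence identity.**  If on the open set `U` the `C³` function `w` is untwisted
(`∂₂w = P(w,y₂)`) and satisfies `Λ(w,y₂)·M + Λ_w(w,y₂)·E + c(w,y₂) = 0` (`E = |∇ₕw|²`, `M = Δₕw`, `Λ_w = DΛ(1,0)`), then also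
`(Λ̇ + ΛP_w)·M + (ΛP_ww + Λ̇_w + 2Λ_wP_w)·E + ċ = 0` on `U`, where `ġ := Dg(w,y₂)(P(w,y₂), 1)` is the derivative along the vertical line.
[folklore] -/
theorem vert_deriv_divIdentity (hU : IsOpen U) (hw : ContDiff ℝ 3 w)
    (hPd : ∀ y ∈ U, ContDiffAt ℝ 2 P (w y, y 2)) (hΛd : ∀ y ∈ U, ContDiffAt ℝ 2 Λ (w y, y 2))
    (hcd : ∀ y ∈ U, DifferentiableAt ℝ c (w y, y 2))
    (hP : ∀ y ∈ U, fderiv ℝ w y (EuclideanSpace.single 2 (1 : ℝ)) = P (w y, y 2))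
    (hK1 : ∀ y ∈ U, Λ (w y, y 2) *
        (fderiv ℝ (fun y' => fderiv ℝ w y' (EuclideanSpace.single 0 (1 : ℝ))) y (EuclideanSpace.single 0 (1 : ℝ)) + fderiv ℝ (fun y' => fderiv ℝ w y' (EuclideanSpace.single 1 (1 : ℝ))) y (EuclideanSpace.single 1 (1 : ℝ))) +
      fderiv ℝ Λ (w y, y 2) (1, 0) * (fderiv ℝ w y (EuclideanSpace.single 0 (1 : ℝ)) ^ 2 + fderiv ℝ w y (EuclideanSpace.single 1 (1 : ℝ)) ^ 2) + c (w y, y 2) = 0)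
    {y : EuclideanSpace ℝ (Fin 3)} (hy : y ∈ U) :
    (fderiv ℝ Λ (w y, y 2) (P (w y, y 2), 1) + Λ (w y, y 2) * fderiv ℝ P (w y, y 2) (1, 0)) *
        (fderiv ℝ (fun y' => fderiv ℝ w y' (EuclideanSpace.single 0 (1 : ℝ))) y (EuclideanSpace.single 0 (1 : ℝ)) + fderiv ℝ (fun y' => fderiv ℝ w y' (EuclideanSpace.single 1 (1 : ℝ))) y (EuclideanSpace.single 1 (1 : ℝ))) +
      (Λ (w y, y 2) * fderiv ℝ (fun q => fderiv ℝ P q ((1 : ℝ), (0 : ℝ))) (w y, y 2) (1, 0) +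
          fderiv ℝ (fun q => fderiv ℝ Λ q ((1 : ℝ), (0 : ℝ))) (w y, y 2) (P (w y, y 2), 1) +
          2 * fderiv ℝ Λ (w y, y 2) (1, 0) * fderiv ℝ P (w y, y 2) (1, 0)) *
        (fderiv ℝ w y (EuclideanSpace.single 0 (1 : ℝ)) ^ 2 + fderiv ℝ w y (EuclideanSpace.single 1 (1 : ℝ)) ^ 2) +
      fderiv ℝ c (w y, y 2) (P (w y, y 2), 1) = 0 := by
  have hw2 : ContDiff ℝ 2 w := hw.of_le (by norm_num)
  have hwd : Differentiable ℝ w := hw.differentiable (by norm_num)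
  have hPd1 : ∀ y ∈ U, DifferentiableAt ℝ P (w y, y 2) := fun y hy => (hPd y hy).differentiableAt (by norm_num)
  -- abbreviations for the functions `M`, `E` and the leafwise coefficients
  set Mf : EuclideanSpace ℝ (Fin 3) → ℝ := fun y' => fderiv ℝ (fun y'' => fderiv ℝ w y'' (EuclideanSpace.single 0 (1 : ℝ))) y' (EuclideanSpace.single 0 (1 : ℝ)) +
    fderiv ℝ (fun y'' => fderiv ℝ w y'' (EuclideanSpace.single 1 (1 : ℝ))) y' (EuclideanSpace.single 1 (1 : ℝ)) with hMf
  set Ef : EuclideanSpace ℝ (Fin 3) → ℝ := fun y' => fderiv ℝ w y' (EuclideanSpace.single 0 (1 : ℝ)) ^ 2 + fderiv ℝ w y' (EuclideanSpace.single 1 (1 : ℝ)) ^ 2 with hEf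
  set Lf : EuclideanSpace ℝ (Fin 3) → ℝ := fun y' => Λ (w y', y' 2) with hLf
  set Lwf : EuclideanSpace ℝ (Fin 3) → ℝ := fun y' => fderiv ℝ Λ (w y', y' 2) ((1 : ℝ), (0 : ℝ)) with hLwf
  set cf : EuclideanSpace ℝ (Fin 3) → ℝ := fun y' => c (w y', y' 2) with hcf
  -- differentiability at `y`
  have hMd : DifferentiableAt ℝ Mf y :=
    (differentiableAt_partial2 hw (EuclideanSpace.single 0 (1 : ℝ)) (EuclideanSpace.single 0 (1 : ℝ)) y).add (differentiableAt_partial2 hw (EuclideanSpace.single 1 (1 : ℝ)) (EuclideanSpace.single 1 (1 : ℝ)) y)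
  have hEd : DifferentiableAt ℝ Ef y :=
    ((differentiableAt_partial hw2 (EuclideanSpace.single 0 (1 : ℝ)) y).pow 2).add ((differentiableAt_partial hw2 (EuclideanSpace.single 1 (1 : ℝ)) y).pow 2)
  have hLd : DifferentiableAt ℝ Lf y := differentiableAt_leaf_comp ((hΛd y hy).differentiableAt (by norm_num)) (hwd y)
  have hLwd : DifferentiableAt ℝ Lwf y := differentiableAt_leaf_comp (differentiableAt_wPartial (hΛd y hy)) (hwd y)
  have hcfd : DifferentiableAt ℝ cf y := differentiableAt_leaf_comp (hcd y hy) (hwd y)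
  -- the identity as a function vanishing on `U`, hence with zero derivative at `y`
  set Φ : EuclideanSpace ℝ (Fin 3) → ℝ := fun y' => Lf y' * Mf y' + Lwf y' * Ef y' + cf y' with hΦ
  have hΦ0 : Φ =ᶠ[𝓝 y] fun _ => 0 := by
    filter_upwards [hU.mem_nhds hy] with y' hy'
    simpa [hΦ, hMf, hEf, hLf, hLwf, hcf] using hK1 y' hy'
  have hD0 : fderiv ℝ Φ y (EuclideanSpace.single 2 (1 : ℝ)) = 0 := by
    rw [hΦ0.fderiv_eq, fderiv_fun_const]; rfl
  -- expand the derivative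
  have hD1 : fderiv ℝ Φ y (EuclideanSpace.single 2 (1 : ℝ)) =
      (Lf y * fderiv ℝ Mf y (EuclideanSpace.single 2 (1 : ℝ)) + Mf y * fderiv ℝ Lf y (EuclideanSpace.single 2 (1 : ℝ))) +
        (Lwf y * fderiv ℝ Ef y (EuclideanSpace.single 2 (1 : ℝ)) + Ef y * fderiv ℝ Lwf y (EuclideanSpace.single 2 (1 : ℝ))) + fderiv ℝ cf y (EuclideanSpace.single 2 (1 : ℝ)) := by
    have hA1 : DifferentiableAt ℝ (fun y' : EuclideanSpace ℝ (Fin 3) => Lf y' * Mf y') y := hLd.mul hMd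
    have hA2 : DifferentiableAt ℝ (fun y' : EuclideanSpace ℝ (Fin 3) => Lwf y' * Ef y') y := hLwd.mul hEd
    have hA : DifferentiableAt ℝ (fun y' : EuclideanSpace ℝ (Fin 3) => Lf y' * Mf y' + Lwf y' * Ef y') y := hA1.add hA2
    rw [hΦ, fderiv_fun_add hA hcfd, fderiv_fun_add hA1 hA2]
    simp only [_root_.add_apply]
    rw [fderiv_mul_apply hLd hMd, fderiv_mul_apply hLwd hEd]
  -- the five pieces
  have h1 : fderiv ℝ Mf y (EuclideanSpace.single 2 (1 : ℝ)) = fderiv ℝ P (w y, y 2) (1, 0) * Mf y +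
      fderiv ℝ (fun q => fderiv ℝ P q ((1 : ℝ), (0 : ℝ))) (w y, y 2) (1, 0) * Ef y := by
    rw [hMf, hEf]; exact fderiv_vert_lap hU hw hPd hP hy
  have h2 : fderiv ℝ Ef y (EuclideanSpace.single 2 (1 : ℝ)) = 2 * fderiv ℝ P (w y, y 2) (1, 0) * Ef y := by
    rw [hEf]; exact fderiv_vert_gradSq hU hw2 hPd1 hP hy
  have h3 : fderiv ℝ Lf y (EuclideanSpace.single 2 (1 : ℝ)) = fderiv ℝ Λ (w y, y 2) (P (w y, y 2), 1) := by
    rw [hLf, fderiv_leaf_comp_vertical ((hΛd y hy).differentiableAt (by norm_num)) (hwd y), hP y hy]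
  have h4 : fderiv ℝ Lwf y (EuclideanSpace.single 2 (1 : ℝ)) = fderiv ℝ (fun q => fderiv ℝ Λ q ((1 : ℝ), (0 : ℝ))) (w y, y 2) (P (w y, y 2), 1) := by
    rw [hLwf, fderiv_leaf_comp_vertical (differentiableAt_wPartial (hΛd y hy)) (hwd y), hP y hy]
  have h5 : fderiv ℝ cf y (EuclideanSpace.single 2 (1 : ℝ)) = fderiv ℝ c (w y, y 2) (P (w y, y 2), 1) := by
    rw [hcf, fderiv_leaf_comp_vertical (hcd y hy) (hwd y), hP y hy]
  rw [hD1, h1, h2, h3, h4, h5] at hD0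
  have e : Lf y = Λ (w y, y 2) := rfl
  have e' : Lwf y = fderiv ℝ Λ (w y, y 2) ((1 : ℝ), (0 : ℝ)) := rfl
  rw [e, e'] at hD0
  linear_combination hD0

/-- **BRANCH 1 OF THE SEPARATION (Cramer).**  Under the hypotheses of `vert_deriv_divIdentity` there are two functions `a, b : ℝ × ℝ → ℝ` of
`(w, y₂)` such that at every point of `U` where the height-Wronskian
`D₁ = Λ(ΛP_ww + Λ̇_w + 2Λ_wP_w) − Λ_w(Λ̇ + ΛP_w)` is non-zero, `E = a(w, y₂)` and `M = b(w, y₂)`: both Beltrami parameters of the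
restriction of `w` to a horizontal plane are constant along its level curves — `w` is ISOPARAMETRIC leaf by leaf.  (UNTWISTED-NOTE §3, Branch 1.)
[folklore] -/
theorem leafwise_of_wronskian_ne_zero (hU : IsOpen U) (hw : ContDiff ℝ 3 w)
    (hPd : ∀ y ∈ U, ContDiffAt ℝ 2 P (w y, y 2)) (hΛd : ∀ y ∈ U, ContDiffAt ℝ 2 Λ (w y, y 2))
    (hcd : ∀ y ∈ U, DifferentiableAt ℝ c (w y, y 2))
    (hP : ∀ y ∈ U, fderiv ℝ w y (EuclideanSpace.single 2 (1 : ℝ)) = P (w y, y 2))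
    (hK1 : ∀ y ∈ U, Λ (w y, y 2) *
        (fderiv ℝ (fun y' => fderiv ℝ w y' (EuclideanSpace.single 0 (1 : ℝ))) y (EuclideanSpace.single 0 (1 : ℝ)) + fderiv ℝ (fun y' => fderiv ℝ w y' (EuclideanSpace.single 1 (1 : ℝ))) y (EuclideanSpace.single 1 (1 : ℝ))) +
      fderiv ℝ Λ (w y, y 2) (1, 0) * (fderiv ℝ w y (EuclideanSpace.single 0 (1 : ℝ)) ^ 2 + fderiv ℝ w y (EuclideanSpace.single 1 (1 : ℝ)) ^ 2) + c (w y, y 2) = 0) :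
    ∃ a b : ℝ × ℝ → ℝ, ∀ y ∈ U,
      Λ (w y, y 2) * (Λ (w y, y 2) * fderiv ℝ (fun q => fderiv ℝ P q ((1 : ℝ), (0 : ℝ))) (w y, y 2) (1, 0) +
            fderiv ℝ (fun q => fderiv ℝ Λ q ((1 : ℝ), (0 : ℝ))) (w y, y 2) (P (w y, y 2), 1) +
            2 * fderiv ℝ Λ (w y, y 2) (1, 0) * fderiv ℝ P (w y, y 2) (1, 0)) -
          fderiv ℝ Λ (w y, y 2) (1, 0) *
            (fderiv ℝ Λ (w y, y 2) (P (w y, y 2), 1) + Λ (w y, y 2) * fderiv ℝ P (w y, y 2) (1, 0)) ≠ 0 →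
        fderiv ℝ w y (EuclideanSpace.single 0 (1 : ℝ)) ^ 2 + fderiv ℝ w y (EuclideanSpace.single 1 (1 : ℝ)) ^ 2 = a (w y, y 2) ∧
          fderiv ℝ (fun y' => fderiv ℝ w y' (EuclideanSpace.single 0 (1 : ℝ))) y (EuclideanSpace.single 0 (1 : ℝ)) + fderiv ℝ (fun y' => fderiv ℝ w y' (EuclideanSpace.single 1 (1 : ℝ))) y (EuclideanSpace.single 1 (1 : ℝ)) = b (w y, y 2) := by
  -- the Cramer formulas, as functions of `p = (w, y₂)`
  refine ⟨fun p => (-(Λ p * fderiv ℝ c p (P p, 1)) +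
        (fderiv ℝ Λ p (P p, 1) + Λ p * fderiv ℝ P p (1, 0)) * c p) /
      (Λ p * (Λ p * fderiv ℝ (fun q => fderiv ℝ P q ((1 : ℝ), (0 : ℝ))) p (1, 0) +
            fderiv ℝ (fun q => fderiv ℝ Λ q ((1 : ℝ), (0 : ℝ))) p (P p, 1) +
            2 * fderiv ℝ Λ p (1, 0) * fderiv ℝ P p (1, 0)) -
        fderiv ℝ Λ p (1, 0) * (fderiv ℝ Λ p (P p, 1) + Λ p * fderiv ℝ P p (1, 0))),
    fun p => (-(c p * (Λ p * fderiv ℝ (fun q => fderiv ℝ P q ((1 : ℝ), (0 : ℝ))) p (1, 0) +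
            fderiv ℝ (fun q => fderiv ℝ Λ q ((1 : ℝ), (0 : ℝ))) p (P p, 1) +
            2 * fderiv ℝ Λ p (1, 0) * fderiv ℝ P p (1, 0))) + fderiv ℝ Λ p (1, 0) * fderiv ℝ c p (P p, 1)) /
      (Λ p * (Λ p * fderiv ℝ (fun q => fderiv ℝ P q ((1 : ℝ), (0 : ℝ))) p (1, 0) +
            fderiv ℝ (fun q => fderiv ℝ Λ q ((1 : ℝ), (0 : ℝ))) p (P p, 1) +
            2 * fderiv ℝ Λ p (1, 0) * fderiv ℝ P p (1, 0)) -
        fderiv ℝ Λ p (1, 0) * (fderiv ℝ Λ p (P p, 1) + Λ p * fderiv ℝ P p (1, 0))),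
    fun y hy hD => ?_⟩
  have h1 := hK1 y hy
  have h2 := vert_deriv_divIdentity hU hw hPd hΛd hcd hP hK1 hy
  -- abbreviate the scalars
  set L := Λ (w y, y 2) with hL
  set Lw := fderiv ℝ Λ (w y, y 2) (1, 0) with hLw
  set Ld := fderiv ℝ Λ (w y, y 2) (P (w y, y 2), 1) with hLd
  set Lwd := fderiv ℝ (fun q => fderiv ℝ Λ q ((1 : ℝ), (0 : ℝ))) (w y, y 2) (P (w y, y 2), 1) with hLwd
  set Pw := fderiv ℝ P (w y, y 2) (1, 0) with hPw
  set Pww := fderiv ℝ (fun q => fderiv ℝ P q ((1 : ℝ), (0 : ℝ))) (w y, y 2) (1, 0) with hPww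
  set cc := c (w y, y 2) with hcc
  set cd := fderiv ℝ c (w y, y 2) (P (w y, y 2), 1) with hcd'
  set Ev := fderiv ℝ w y (EuclideanSpace.single 0 (1 : ℝ)) ^ 2 + fderiv ℝ w y (EuclideanSpace.single 1 (1 : ℝ)) ^ 2 with hEv
  set Mv := fderiv ℝ (fun y' => fderiv ℝ w y' (EuclideanSpace.single 0 (1 : ℝ))) y (EuclideanSpace.single 0 (1 : ℝ)) + fderiv ℝ (fun y' => fderiv ℝ w y' (EuclideanSpace.single 1 (1 : ℝ))) y (EuclideanSpace.single 1 (1 : ℝ)) with hMv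
  set D := L * (L * Pww + Lwd + 2 * Lw * Pw) - Lw * (Ld + L * Pw) with hDdef
  have hD' : D ≠ 0 := hD
  constructor
  · show Ev = (-(L * cd) + (Ld + L * Pw) * cc) / D
    rw [eq_div_iff hD']
    have : D * Ev = -(L * cd) + (Ld + L * Pw) * cc := by
      rw [hDdef]; linear_combination (-(Ld + L * Pw)) * h1 + L * h2
    linarith [this]
  · show Mv = (-(cc * (L * Pww + Lwd + 2 * Lw * Pw)) + Lw * cd) / D
    rw [eq_div_iff hD']
    have : D * Mv = -(cc * (L * Pww + Lwd + 2 * Lw * Pw)) + Lw * cd := by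
      rw [hDdef]; linear_combination (L * Pww + Lwd + 2 * Lw * Pw) * h1 - Lw * h2
    linarith [this]

end DivIdentity

end Summit.NavierStokesRegularity.NavierStokesRegularity.Theorems.PoloidalWindowDoorPoloidalWindowRigidityUntwistedSeparation

end
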